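import Literature.MathematicalPhysics.KineticTheory.HardSphereBBGKYLiouvilleSubsystem
import HarnessLib

/-!
# The untagged subsystem of a hard-sphere flow between tagged–untagged collisions

Companion to `HardSphereBBGKYLiouvilleSubsystem` (whose `HardSphereFlow.tagged_flow_eq` says: as
long as no tagged particle touches an untagged one, the tagged part of the `(s+m)`-orbit is the
`s`-orbit of its initial value). This file PROVES the mirror statement for the UNTAGGED part
(the last `m` particles, `z ∘ Fin.natAdd s`): under the same hypothesis it follows the `m`-sphere
flow of its initial value (`HardSphereFlow.untagged_flow_eq`). Together the two lemmas say that
between tagged–untagged collisions the `(s+m)`-sphere dynamics is the product of the `s`-sphere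
and the `m`-sphere dynamics — the decoupling used in the derivation of the BBGKY hierarchy to
identify the marginal `f^{(s)}(t - u)` read along the backward `s`-flow with an integral over the
big phase space (CIP 1994 §4.3, App. 4.B; Spohn 2006 §2), in particular in the trace identity
for the marginals at contact configurations (towards the contact-trace form (H1♯) of the
one-step hierarchy, `TaggedSphereOneStepInputs`). Same proof as the tagged lemma: the untagged
part of the big orbit is free flight between the collision times of the orbit, jumps by the
elastic law at untagged–untagged collisions and is continuous at tagged–tagged ones, so the local
forward uniqueness `eqOn_Icc_of_hardSphereEvents` applies.

* §1 restriction to the untagged particles: `freeFlight_comp_natAdd`,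
  `comp_natAdd_mem_hardSphereDomain`, `comp_natAdd_mem_contactSet_iff`,
  `collidePair_comp_natAdd`, `collidePair_castAdd_comp_natAdd`, `continuous_comp_natAdd`;
* §2 `HardSphereFlow.untagged_flow_eq`, `HardSphereFlow.untagged_flow_eq_of_flow`.

Theorems only; no definition, no named fact.

## References

* C. Cercignani, R. Illner, M. Pulvirenti, *The Mathematical Theory of Dilute Gases*, Springer
  (1994), §4.3, App. 4.A–4.B.
* H. Spohn, *On the integrated form of the BBGKY hierarchy for hard spheres*,
  arXiv:math-ph/0605068, §2.
* I. Gallagher, L. Saint-Raymond, B. Texier, *From Newton to Boltzmann*, EMS (2013),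
  arXiv:1208.5753, §4.1, §4.3.
-/

open MeasureTheory Set Filter Topology

namespace Literature.MathematicalPhysics.KineticTheory

open Literature.Analysis.FluidPDE

noncomputable section

variable {d : Type*} [Fintype d] {X : Type*}

/-! ## §1. Restriction to the untagged particles -/

section Untagged

variable [TopologicalSpace X] {G : Geometry d X} {ε : ℝ} {s m : ℕ}

omit [TopologicalSpace X] in
/-- Restriction to the untagged particles commutes with free flight. [folklore] -/
theorem freeFlight_comp_natAdd (t : ℝ) (z : Config (s + m) d X) :
    (freeFlight G t z ∘ Fin.natAdd s : Config m d X) = freeFlight G t (z ∘ Fin.natAdd s) := rfl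

omit [TopologicalSpace X] in
/-- A configuration of the hard-sphere domain restricts to one (untagged particles). [folklore] -/
theorem comp_natAdd_mem_hardSphereDomain {z : Config (s + m) d X}
    (hz : z ∈ hardSphereDomain G (s + m) ε) :
    (z ∘ Fin.natAdd s : Config m d X) ∈ hardSphereDomain G m ε := by
  rw [mem_hardSphereDomain] at hz ⊢
  intro i j hij
  exact hz (Fin.natAdd s i) (Fin.natAdd s j) fun h => hij (Fin.natAdd_injective _ _ h)

omit [TopologicalSpace X] in
/-- For a configuration of the hard-sphere domain, the untagged part is a contact configuration
of the untagged pair `(i, j)` iff the configuration is one of `(natAdd i, natAdd j)`. [folklore] -/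
theorem comp_natAdd_mem_contactSet_iff {z : Config (s + m) d X}
    (hz : z ∈ hardSphereDomain G (s + m) ε) (i j : Fin m) :
    (z ∘ Fin.natAdd s : Config m d X) ∈ contactSet G m ε i j ↔
      z ∈ contactSet G (s + m) ε (Fin.natAdd s i) (Fin.natAdd s j) := by
  simp only [mem_contactSet, hz, comp_natAdd_mem_hardSphereDomain hz, true_and,
    Function.comp_apply]

omit [TopologicalSpace X] in
/-- Restriction to the untagged particles commutes with the collision of an untagged pair.
[folklore] -/
theorem collidePair_comp_natAdd {i j : Fin m} (hij : i ≠ j) (z : Config (s + m) d X) :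
    (collidePair G (Fin.natAdd s i) (Fin.natAdd s j) z ∘ Fin.natAdd s : Config m d X) =
      collidePair G i j (z ∘ Fin.natAdd s) := by
  have hIJ : Fin.natAdd s i ≠ Fin.natAdd s j := fun h => hij (Fin.natAdd_injective _ _ h)
  funext k
  by_cases hkj : k = j
  · subst hkj
    simp only [Function.comp_apply, collidePair_apply_right]
  by_cases hki : k = i
  · subst hki
    simp only [Function.comp_apply, collidePair_apply_left hIJ, collidePair_apply_left hij]
  · have hkI : Fin.natAdd s k ≠ Fin.natAdd s i := fun h => hki (Fin.natAdd_injective _ _ h)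
    have hkJ : Fin.natAdd s k ≠ Fin.natAdd s j := fun h => hkj (Fin.natAdd_injective _ _ h)
    simp only [Function.comp_apply, collidePair_apply_of_ne hkI hkJ, collidePair_apply_of_ne hki hkj]

omit [TopologicalSpace X] in
/-- The collision of a tagged pair does not affect the untagged particles. [folklore] -/
theorem collidePair_castAdd_comp_natAdd (i j : Fin s) (z : Config (s + m) d X) :
    (collidePair G (Fin.castAdd m i) (Fin.castAdd m j) z ∘ Fin.natAdd s : Config m d X) =
      z ∘ Fin.natAdd s := by
  funext k
  have hkI : Fin.natAdd s k ≠ Fin.castAdd m i := fun h => by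
    have := congrArg Fin.val h
    simp at this
    omega
  have hkJ : Fin.natAdd s k ≠ Fin.castAdd m j := fun h => by
    have := congrArg Fin.val h
    simp at this
    omega
  simp only [Function.comp_apply, collidePair_apply_of_ne hkI hkJ]

omit [Fintype d] in
/-- Restriction to the untagged particles is continuous. [folklore] -/
theorem continuous_comp_natAdd :
    Continuous fun z : Config (s + m) d X => (z ∘ Fin.natAdd s : Config m d X) :=
  continuous_pi fun _ => continuous_apply _

end Untagged

/-! ## §2. The untagged subsystem lemma -/

section Subsystem

variable [MeasureSpace X] [TopologicalSpace X] {G : Geometry d X} {ε : ℝ} {s m : ℕ}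

/-- **The untagged subsystem follows its own flow between tagged–untagged collisions.** Let
`Φm`, `ΦN` be hard-sphere flows of `m` and `s + m` particles (same geometry and diameter), `z` a
good datum of `ΦN` whose untagged part `z ∘ Fin.natAdd s` is good for `Φm`, and `h ≥ 0` such
that every contact of the orbit `ΦN_τ z`, `τ ∈ (0, h]`, is between two tagged or two untagged
particles. Then for `τ ∈ [0, h]` the untagged part of `ΦN_τ z` is `Φm_τ (z ∘ Fin.natAdd s)`
(the mirror of `HardSphereFlow.tagged_flow_eq`: the untagged part is free flight between the
collision times of the orbit, jumps by the elastic law at untagged–untagged collisions and is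
continuous at tagged–tagged ones; `eqOn_Icc_of_hardSphereEvents`). [cite: CIP1994, §4.3 and App. 4.B] -/
theorem _root_.Literature.Analysis.FluidPDE.HardSphereFlow.untagged_flow_eq [T2Space X]
    (hG : ∀ x : X, Continuous (G.translate x)) (Φm : HardSphereFlow G ε m)
    (ΦN : HardSphereFlow G ε (s + m)) {z : Config (s + m) d X} (hz : z ∈ ΦN.good)
    (hzm : (z ∘ Fin.natAdd s : Config m d X) ∈ Φm.good) {h : ℝ}
    (hnc : ∀ τ ∈ Ioc 0 h, ∀ I J : Fin (s + m), I ≠ J →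
      ΦN.flow τ z ∈ contactSet G (s + m) ε I J → ((I : ℕ) < s ↔ (J : ℕ) < s)) :
    ∀ τ ∈ Icc 0 h, (ΦN.flow τ z ∘ Fin.natAdd s : Config m d X) =
      Φm.flow τ (z ∘ Fin.natAdd s) := by
  have hγN := ΦN.isTrajectory z hz
  have hγm := Φm.isTrajectory _ hzm
  set γ : ℝ → Config m d X := fun τ => (ΦN.flow τ z ∘ Fin.natAdd s : Config m d X) with hγdef
  set γ' : ℝ → Config m d X := fun τ => Φm.flow τ (z ∘ Fin.natAdd s) with hγ'def
  set E : Set ℝ := collisionTimes G ε fun τ => ΦN.flow τ z with hEdef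
  set E' : Set ℝ := collisionTimes G ε γ' with hE'def
  have huc : ∀ τ (i j : Fin m), γ τ ∈ contactSet G m ε i j →
      ΦN.flow τ z ∈ contactSet G (s + m) ε (Fin.natAdd s i) (Fin.natAdd s j) :=
    fun τ i j hc => (comp_natAdd_mem_contactSet_iff (hγN.mem τ) i j).1 hc
  have key : EqOn γ γ' (Icc 0 h) := by
    refine eqOn_Icc_of_hardSphereEvents (G := G) (ε := ε) hG (E := E) (E' := E')
      (hγN.locFinite 0 h) (hγm.locFinite 0 h) ?_ ?_ ?_ ?_ ?_ ?_ ?_ ?_ ?_ ?_ ?_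
    · intro i
      exact hγN.pos_continuous (Fin.natAdd s i)
    · intro i
      exact hγm.pos_continuous i
    · intro σ τ _ hστ _ hfree
      show (ΦN.flow τ z ∘ Fin.natAdd s : Config m d X) = _
      rw [hγN.free σ τ hστ hfree]
      rfl
    · intro σ τ _ hστ _ hfree
      exact hγm.free σ τ hστ hfree
    · -- untagged–untagged contact: jump of the untagged part
      intro τ _ _ i j hij hc
      have hIJ : Fin.natAdd s i ≠ Fin.natAdd s j := fun h => hij (Fin.natAdd_injective _ _ h)
      obtain ⟨-, zl, hzl, -, heq⟩ := hγN.binary τ _ _ hIJ (huc τ i j hc)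
      refine ⟨zl ∘ Fin.natAdd s, ?_, ?_⟩
      · exact ((continuous_comp_natAdd (s := s) (m := m)).tendsto zl).comp hzl
      · show (ΦN.flow τ z ∘ Fin.natAdd s : Config m d X) = _
        rw [heq, collidePair_comp_natAdd hij]
    · intro τ _ _ i j hij hc
      obtain ⟨-, zl, hzl, -, heq⟩ := hγm.binary τ i j hij hc
      exact ⟨zl, hzl, heq⟩
    · -- an event of the big orbit which is not an untagged contact is a tagged–tagged
      -- collision: the untagged part is (left-)continuous there
      intro τ hτ hτE hnot
      obtain ⟨I, J, hIJ, hc⟩ := hτE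
      have hIJ' := hnc τ hτ I J hIJ hc
      rcases eq_castAdd_or_eq_natAdd I with ⟨i, rfl⟩ | ⟨i, rfl⟩
      · rcases eq_castAdd_or_eq_natAdd J with ⟨j, rfl⟩ | ⟨j, rfl⟩
        · -- tagged–tagged collision
          obtain ⟨-, zl, hzl, -, heq⟩ := hγN.binary τ _ _ hIJ hc
          have hlim : Tendsto γ (𝓝[<] τ) (𝓝 (zl ∘ Fin.natAdd s)) :=
            ((continuous_comp_natAdd (s := s) (m := m)).tendsto zl).comp hzl
          have hval : γ τ = (zl ∘ Fin.natAdd s : Config m d X) := by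
            show (ΦN.flow τ z ∘ Fin.natAdd s : Config m d X) = _
            rw [heq, collidePair_castAdd_comp_natAdd]
          rw [hval]
          exact hlim
        · exfalso
          have h1 : ((Fin.castAdd m i : Fin (s + m)) : ℕ) < s := by simp
          have h2 : ¬ ((Fin.natAdd s j : Fin (s + m)) : ℕ) < s := by simp
          exact h2 (hIJ'.1 h1)
      · rcases eq_castAdd_or_eq_natAdd J with ⟨j, rfl⟩ | ⟨j, rfl⟩
        · exfalso
          have h1 : ((Fin.castAdd m j : Fin (s + m)) : ℕ) < s := by simp
          have h2 : ¬ ((Fin.natAdd s i : Fin (s + m)) : ℕ) < s := by simp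
          exact h2 (hIJ'.2 h1)
        · -- `I`, `J` untagged: an untagged contact, excluded
          have hij : i ≠ j := fun h => hIJ (h ▸ rfl)
          exact absurd ((comp_natAdd_mem_contactSet_iff (hγN.mem τ) i j).2 hc) (hnot i j hij)
    · intro τ _ hτE hnot
      obtain ⟨i, j, hij, hc⟩ := hτE
      exact absurd hc (hnot i j hij)
    · intro τ _ i j hij hc
      have hIJ : Fin.natAdd s i ≠ Fin.natAdd s j := fun h => hij (Fin.natAdd_injective _ _ h)
      exact ⟨_, _, hIJ, huc τ i j hc⟩
    · intro τ _ i j hij hc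
      exact ⟨i, j, hij, hc⟩
    · show (ΦN.flow 0 z ∘ Fin.natAdd s : Config m d X) = Φm.flow 0 (z ∘ Fin.natAdd s)
      rw [ΦN.flow_zero z hz, Φm.flow_zero _ hzm]
  intro τ hτ
  exact key hτ

/-- The untagged subsystem lemma from an arbitrary initial time (group property and
`untagged_flow_eq`). [folklore] -/
theorem _root_.Literature.Analysis.FluidPDE.HardSphereFlow.untagged_flow_eq_of_flow [T2Space X]
    (hG : ∀ x : X, Continuous (G.translate x)) (Φm : HardSphereFlow G ε m)
    (ΦN : HardSphereFlow G ε (s + m)) {z : Config (s + m) d X} (hz : z ∈ ΦN.good) (t₀ : ℝ)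
    (hzm : (ΦN.flow t₀ z ∘ Fin.natAdd s : Config m d X) ∈ Φm.good) {h : ℝ}
    (hnc : ∀ τ ∈ Ioc t₀ (t₀ + h), ∀ I J : Fin (s + m), I ≠ J →
      ΦN.flow τ z ∈ contactSet G (s + m) ε I J → ((I : ℕ) < s ↔ (J : ℕ) < s)) :
    ∀ τ ∈ Icc 0 h, (ΦN.flow (t₀ + τ) z ∘ Fin.natAdd s : Config m d X) =
      Φm.flow τ (ΦN.flow t₀ z ∘ Fin.natAdd s) := by
  intro τ hτ
  have hz₀ : ΦN.flow t₀ z ∈ ΦN.good := ΦN.mapsTo_good t₀ hz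
  have h1 : ΦN.flow (t₀ + τ) z = ΦN.flow τ (ΦN.flow t₀ z) := by
    rw [show t₀ + τ = τ + t₀ from add_comm _ _, ΦN.flow_add τ t₀ z hz]
  rw [h1]
  refine HardSphereFlow.untagged_flow_eq hG Φm ΦN hz₀ hzm (fun σ hσ I J hIJ hc => ?_) τ hτ
  refine hnc (t₀ + σ) ⟨by linarith [hσ.1], by linarith [hσ.2]⟩ I J hIJ ?_
  rw [show t₀ + σ = σ + t₀ from add_comm _ _, ΦN.flow_add σ t₀ z hz]
  exact hc

end Subsystem

end

end Literature.MathematicalPhysics.KineticTheory
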